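import Mathlib.FieldTheory.Galois.Basic
import Mathlib.GroupTheory.SpecificGroups.Cyclic
import Mathlib.GroupTheory.Perm.Cycle.Type
import Mathlib.LinearAlgebra.LinearIndependent.Basic
import Literature.FieldTheory.Kummer.KummerEigenDescent
import HarnessLib

/-!
# A cyclic layer of prime degree as a Kummer extension: generator, uniqueness, isotypy

Topic `FieldTheory/Kummer`; theorems only (no definition, no named fact), continuing
`KummerEigenDescent`.  This file is the *local* (group-theoretic) half of Hecke's construction of
cyclic extensions of prime degree `ℓ` with prescribed completion: everything is phrased for a
field `Ω ⊇ K₀`, the group `G = Ω ≃ₐ[K₀] Ω` acting on `Ω`, a primitive `ℓ`-th root of unity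
`ζ ∈ Ω`, and subgroups `W' ≤ W ≤ G` with `W'` normal of prime index `ℓ` in `W` and `W` fixing `ζ`
(think: `W = Gal(Ω / k(ζ))`, `W' = Gal(Ω / K'(ζ))` for a cyclic extension `K'/k` of degree `ℓ`).

* Group theory: `exists_pow_mul_mem_of_relIndex_prime` (`W = ⋃ sⁱ W'` for any `s ∈ W ∖ W'`),
  `pow_mem_of_relIndex_prime` (`w ^ ℓ ∈ W'`), `relIndex_comap_dvd` (indices of preimages divide),
  and the **Hall-type uniqueness** `eq_of_relIndex_eq_prime_of_commutator_le`: in a group `H` with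
  commutators in `W'`, two subgroups `X, H' ⊇ W'` of index `ℓ` in `H` and of index `d` over `W'`
  with `ℓ ∤ d` coincide (the `ℓ'`-part of the abelian group `H/W'` is unique).
* **Kummer generator** `exists_kummer_generator` (Lagrange resolvent + Dedekind's independence of
  characters): there is `β ≠ 0` fixed by `W'` with `s β = ζ β`; hence `b = β ^ ℓ` is fixed by `W`
  (`apply_pow_eq_of_kummer`), the stabiliser of `β` in `W` is `W'` (`apply_eq_iff_mem_of_kummer`).
* **Kummer uniqueness** `exists_eq_mul_pow_of_kummer`: an element fixed by `W'` whose `ℓ`-th power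
  is fixed by `W` is `e · β ^ j` with `e` fixed by `W`.
* **Isotypy** `apply_pow_eq_of_comm_of_kummer`: if `σ ∈ G` normalises `W` and `W'`, commutes with
  `s` modulo `W'`, and `σ ζ = ζ ^ n`, then `σ b = b ^ j · e ^ ℓ` with `j ≡ n (mod ℓ)`, `e` fixed by
  `W` — the class of `b` modulo `ℓ`-th powers is an eigenvector for the cyclotomic character
  (Hecke; Cohen, *Advanced Topics in Computational Number Theory*, Thm. 10.2.9; Washington,
  *Cyclotomic Fields*, §10.2).
* `apply_eq_iff_apply_eq_of_pow_eq`, `pow_ne_of_kummer`: for `x` with `x ^ ℓ = (β ^ d z) ^ ℓ`,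
  `ℓ ∤ d`, `z ≠ 0` fixed by `W`, an element of `W` fixes `x` iff it fixes `β`; and `(β^d z)^ℓ` is
  not the `ℓ`-th power of a `W`-fixed element.

## References

* H. Cohen, *Advanced Topics in Computational Number Theory*, GTM 193 (2000), §10.2.3,
  Thm. 10.2.9 (Kummer theory when `ζ_ℓ ∉ K`, via `K(ζ_ℓ)` and eigen-components). [folklore]
* L. C. Washington, *Introduction to Cyclotomic Fields*, GTM 83, §10.2. [folklore]
* S. Lang, *Algebra*, GTM 211, Ch. VI §6 (cyclic extensions, Hilbert 90 / Lagrange resolvents),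
  Ch. VI §4 (independence of characters). [folklore]
-/

noncomputable section

open scoped BigOperators

namespace Literature.FieldTheory.Kummer

/-! ### Group theory of a normal subgroup of prime index -/

section Group

variable {G : Type*} [Group G]

/-- If `W' ≤ W` is normal of prime index `p` in `W` and `s ∈ W ∖ W'`, every `w ∈ W` is `sⁱ w'`
with `i < p`, `w' ∈ W'` (`W/W'` is cyclic of order `p`, generated by `s`). [folklore] -/
theorem exists_pow_mul_mem_of_relIndex_prime {W W' : Subgroup G} (hle : W' ≤ W)
    (hnorm : ∀ w ∈ W, ∀ w' ∈ W', w * w' * w⁻¹ ∈ W') {p : ℕ} (hp : p.Prime)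
    (hidx : W'.relIndex W = p) {s : G} (hs : s ∈ W) (hs' : s ∉ W') {w : G} (hw : w ∈ W) :
    ∃ i < p, ∃ w' ∈ W', w = s ^ i * w' := by
  haveI : Fact p.Prime := ⟨hp⟩
  haveI hN : (W'.subgroupOf W).Normal :=
    (Subgroup.normal_subgroupOf_iff hle).2 fun h k hh hk => hnorm k hk h hh
  have hcard : Nat.card (W ⧸ W'.subgroupOf W) = p := by
    rw [← Subgroup.index_eq_card]; exact hidx
  have hs1 : (QuotientGroup.mk (s := W'.subgroupOf W) ⟨s, hs⟩ : W ⧸ W'.subgroupOf W) ≠ 1 := by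
    rw [Ne, QuotientGroup.eq_one_iff, Subgroup.mem_subgroupOf]
    exact hs'
  haveI : Finite (W ⧸ W'.subgroupOf W) := Nat.finite_of_card_ne_zero (by rw [hcard]; exact hp.ne_zero)
  have htop := zpowers_eq_top_of_prime_card hcard hs1
  have hmem : (QuotientGroup.mk (s := W'.subgroupOf W) ⟨w, hw⟩ : W ⧸ W'.subgroupOf W) ∈
      Subgroup.zpowers (QuotientGroup.mk (s := W'.subgroupOf W) ⟨s, hs⟩) := by
    rw [htop]; exact Subgroup.mem_top _
  rw [← mem_powers_iff_mem_zpowers] at hmem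
  obtain ⟨i, hi⟩ := hmem
  have hi2 : (QuotientGroup.mk (s := W'.subgroupOf W) (⟨s, hs⟩ ^ i) : W ⧸ W'.subgroupOf W) =
      QuotientGroup.mk ⟨w, hw⟩ := by
    rw [QuotientGroup.mk_pow]; exact hi
  have hi' : (s ^ i)⁻¹ * w ∈ W' := by
    have := QuotientGroup.eq.1 hi2
    rw [Subgroup.mem_subgroupOf] at this
    simpa using this
  have hsp : s ^ p ∈ W' := by
    have h1 : (QuotientGroup.mk (s := W'.subgroupOf W) ⟨s, hs⟩ : W ⧸ W'.subgroupOf W) ^ p = 1 := by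
      rw [← hcard]; exact pow_card_eq_one'
    rw [← QuotientGroup.mk_pow, QuotientGroup.eq_one_iff, Subgroup.mem_subgroupOf] at h1
    simpa using h1
  refine ⟨i % p, Nat.mod_lt _ hp.pos, (s ^ p) ^ (i / p) * ((s ^ i)⁻¹ * w),
    W'.mul_mem (W'.pow_mem hsp _) hi', ?_⟩
  rw [← mul_assoc, ← mul_assoc, ← pow_mul, ← pow_add, Nat.mod_add_div, mul_inv_cancel, one_mul]

/-- If `W' ≤ W` is normal of prime index `p` in `W`, then `w ^ p ∈ W'` for every `w ∈ W`.
[folklore] -/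
theorem pow_mem_of_relIndex_prime {W W' : Subgroup G} (hle : W' ≤ W)
    (hnorm : ∀ w ∈ W, ∀ w' ∈ W', w * w' * w⁻¹ ∈ W') {p : ℕ} (hp : p.Prime)
    (hidx : W'.relIndex W = p) {w : G} (hw : w ∈ W) : w ^ p ∈ W' := by
  by_cases hw' : w ∈ W'
  · exact W'.pow_mem hw' _
  · obtain ⟨i, -, w', hw'W, hi⟩ := exists_pow_mul_mem_of_relIndex_prime hle hnorm hp hidx hw hw'
      (W.pow_mem hw p)
    haveI : Fact p.Prime := ⟨hp⟩
    haveI hN : (W'.subgroupOf W).Normal :=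
      (Subgroup.normal_subgroupOf_iff hle).2 fun h k hh hk => hnorm k hk h hh
    have hcard : Nat.card (W ⧸ W'.subgroupOf W) = p := by
      rw [← Subgroup.index_eq_card]; exact hidx
    have h1 : (QuotientGroup.mk (s := W'.subgroupOf W) ⟨w, hw⟩ : W ⧸ W'.subgroupOf W) ^ p = 1 := by
      rw [← hcard]; exact pow_card_eq_one'
    rw [← QuotientGroup.mk_pow, QuotientGroup.eq_one_iff, Subgroup.mem_subgroupOf] at h1
    simpa using h1

/-- If `N ≤ X` is normal of index `d` in `X`, then `x ^ d ∈ N` for `x ∈ X` (for infinite index,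
`d = 0` and the statement is trivial). [folklore] -/
theorem pow_relIndex_mem {X N : Subgroup G} (hle : N ≤ X)
    (hnorm : ∀ x ∈ X, ∀ n ∈ N, x * n * x⁻¹ ∈ N) {x : G} (hx : x ∈ X) :
    x ^ N.relIndex X ∈ N := by
  haveI hN : (N.subgroupOf X).Normal :=
    (Subgroup.normal_subgroupOf_iff hle).2 fun h k hh hk => hnorm k hk h hh
  have h1 : (QuotientGroup.mk (s := N.subgroupOf X) ⟨x, hx⟩ : X ⧸ N.subgroupOf X) ^
      N.relIndex X = 1 := by
    rw [Subgroup.relIndex, Subgroup.index_eq_card]; exact pow_card_eq_one'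
  rw [← QuotientGroup.mk_pow, QuotientGroup.eq_one_iff, Subgroup.mem_subgroupOf] at h1
  simpa using h1

/-- **Indices of preimages divide.**  For a homomorphism `f : G → G'` and subgroups `B ≤ A` of `G'`
with `B` normal in `A`, the index of `f⁻¹ B` in `f⁻¹ A` divides the index of `B` in `A`
(`f⁻¹A / f⁻¹B` embeds in `A / B`). [folklore] -/
theorem relIndex_comap_dvd {G' : Type*} [Group G'] (f : G →* G') {A B : Subgroup G'} (hle : B ≤ A)
    (hnorm : ∀ a ∈ A, ∀ b ∈ B, a * b * a⁻¹ ∈ B) :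
    (B.comap f).relIndex (A.comap f) ∣ B.relIndex A := by
  haveI hN : (B.subgroupOf A).Normal :=
    (Subgroup.normal_subgroupOf_iff hle).2 fun h k hh hk => hnorm k hk h hh
  haveI hN' : ((B.comap f).subgroupOf (A.comap f)).Normal :=
    (Subgroup.normal_subgroupOf_iff (Subgroup.comap_mono hle)).2 fun h k hh hk => by
      simp only [Subgroup.mem_comap, map_mul, map_inv] at hh hk ⊢
      exact hnorm _ hk _ hh
  -- the map `f⁻¹A → A → A/B`
  let φ : (A.comap f) →* A ⧸ B.subgroupOf A :=
    (QuotientGroup.mk' (B.subgroupOf A)).comp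
      ((f.comp (A.comap f).subtype).codRestrict A fun x => x.2)
  have hker : φ.ker = (B.comap f).subgroupOf (A.comap f) := by
    ext x
    simp [φ, MonoidHom.mem_ker, QuotientGroup.eq_one_iff, Subgroup.mem_subgroupOf]
  rw [Subgroup.relIndex, Subgroup.relIndex, ← hker, Subgroup.index_ker, Subgroup.index_eq_card]
  exact Subgroup.card_subgroup_dvd_card φ.range

/-- **Hall-type uniqueness.**  Let `W' ≤ X ≤ H` and `W' ≤ H' ≤ H` be subgroups with all
commutators of `H` in `W'` (so `H/W'` is abelian), `[H : X] = [H : H'] = ℓ` prime and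
`[X : W'] = [H' : W'] = d` with `ℓ ∤ d`.  Then `X = H'`: otherwise `H = ⋃ xⁱ H'` for some
`x ∈ X ∖ H'` and every element of `H/W'` would have order dividing `d`, contradicting Cauchy's
theorem for the prime `ℓ ∣ #(H/W') = ℓ d`. [folklore] -/
theorem eq_of_relIndex_eq_prime_of_commutator_le {H X H' W' : Subgroup G}
    (hXH : X ≤ H) (hH'H : H' ≤ H) (hW'X : W' ≤ X) (hW'H' : W' ≤ H')
    (hcomm : ∀ a ∈ H, ∀ b ∈ H, a * b * a⁻¹ * b⁻¹ ∈ W') {ℓ d : ℕ} (hℓ : ℓ.Prime) (hℓd : ¬ ℓ ∣ d)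
    (hX : X.relIndex H = ℓ) (hH' : H'.relIndex H = ℓ) (hXd : W'.relIndex X = d)
    (hH'd : W'.relIndex H' = d) : X = H' := by
  classical
  haveI : Fact ℓ.Prime := ⟨hℓ⟩
  have hd0 : d ≠ 0 := fun h => hℓd (h ▸ dvd_zero ℓ)
  -- conjugation lemmas from the commutator condition
  have hconj : ∀ {Y : Subgroup G}, W' ≤ Y → Y ≤ H → ∀ a ∈ H, ∀ y ∈ Y, a * y * a⁻¹ ∈ Y := by
    intro Y hW'Y hYH a ha y hy
    have := hcomm a ha y (hYH hy)
    have h2 : a * y * a⁻¹ = (a * y * a⁻¹ * y⁻¹) * y := by group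
    rw [h2]
    exact Y.mul_mem (hW'Y this) hy
  by_cases hle : X ≤ H'
  · -- equal indices force equality
    have h1 := Subgroup.relIndex_mul_relIndex X H' H hle hH'H
    rw [hX, hH'] at h1
    have h2 : X.relIndex H' = 1 := by
      have : X.relIndex H' * ℓ = 1 * ℓ := by rw [one_mul]; exact h1
      exact Nat.eq_of_mul_eq_mul_right hℓ.pos this
    exact le_antisymm hle (Subgroup.relIndex_eq_one.1 h2)
  · exfalso
    obtain ⟨x, hxX, hxH'⟩ := Set.not_subset.1 hle
    have hxH : x ∈ H := hXH hxX
    -- every `h ∈ H` is `x ^ i * h'` with `h' ∈ H'`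
    have hdecomp : ∀ h ∈ H, ∃ i < ℓ, ∃ h' ∈ H', h = x ^ i * h' := fun h hh =>
      exists_pow_mul_mem_of_relIndex_prime hH'H (hconj hW'H' hH'H) hℓ hH' hxH hxH' hh
    -- `d`-th powers of `X` and of `H'` lie in `W'`
    have hpowX : ∀ y ∈ X, y ^ d ∈ W' := fun y hy => by
      have := pow_relIndex_mem hW'X
        (fun a ha b hb => hconj le_rfl (hW'X.trans hXH) a (hXH ha) b hb) hy
      rwa [hXd] at this
    have hpowH' : ∀ y ∈ H', y ^ d ∈ W' := fun y hy => by
      have := pow_relIndex_mem hW'H'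
        (fun a ha b hb => hconj le_rfl (hW'H'.trans hH'H) a (hH'H ha) b hb) hy
      rwa [hH'd] at this
    -- pass to the quotient `Q = H / W'`
    have hW'H : W' ≤ H := hW'X.trans hXH
    haveI hN : (W'.subgroupOf H).Normal :=
      (Subgroup.normal_subgroupOf_iff hW'H).2 fun h k hh hk => hconj le_rfl hW'H k hk h hh
    have hcardQ : Nat.card (H ⧸ W'.subgroupOf H) = d * ℓ := by
      rw [← Subgroup.index_eq_card]
      show W'.relIndex H = d * ℓ
      rw [← Subgroup.relIndex_mul_relIndex W' H' H hW'H' hH'H, hH'd, hH']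
    haveI : Finite (H ⧸ W'.subgroupOf H) := by
      apply Nat.finite_of_card_ne_zero
      rw [hcardQ]; exact mul_ne_zero hd0 hℓ.ne_zero
    -- every element of `Q` has `d`-th power `1`
    have hpowQ : ∀ q : H ⧸ W'.subgroupOf H, q ^ d = 1 := by
      intro q
      obtain ⟨⟨h, hh⟩, rfl⟩ := QuotientGroup.mk_surjective q
      obtain ⟨i, -, h', hh', rfl⟩ := hdecomp h hh
      have hxi : x ^ i ∈ H := H.pow_mem hxH i
      have hh'H : h' ∈ H := hH'H hh'
      have hmk : (QuotientGroup.mk (s := W'.subgroupOf H) ⟨x ^ i * h', hh⟩ : H ⧸ W'.subgroupOf H) =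
          QuotientGroup.mk (s := W'.subgroupOf H) ⟨x ^ i, hxi⟩ *
            QuotientGroup.mk (s := W'.subgroupOf H) ⟨h', hh'H⟩ := by
        rw [← QuotientGroup.mk_mul]; rfl
      have hc : Commute (QuotientGroup.mk (s := W'.subgroupOf H) ⟨x ^ i, hxi⟩ : H ⧸ W'.subgroupOf H)
          (QuotientGroup.mk (s := W'.subgroupOf H) ⟨h', hh'H⟩) := by
        rw [Commute, SemiconjBy, ← QuotientGroup.mk_mul, ← QuotientGroup.mk_mul, QuotientGroup.eq,
          Subgroup.mem_subgroupOf]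
        have := hcomm h'⁻¹ (H.inv_mem hh'H) (x ^ i)⁻¹ (H.inv_mem hxi)
        simpa [mul_assoc] using this
      have h1 : (QuotientGroup.mk (s := W'.subgroupOf H) ⟨x ^ i, hxi⟩ : H ⧸ W'.subgroupOf H) ^ d = 1 := by
        rw [← QuotientGroup.mk_pow, QuotientGroup.eq_one_iff, Subgroup.mem_subgroupOf]
        have := hpowX (x ^ i) (X.pow_mem hxX i)
        simpa using this
      have h2 : (QuotientGroup.mk (s := W'.subgroupOf H) ⟨h', hh'H⟩ : H ⧸ W'.subgroupOf H) ^ d = 1 := by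
        rw [← QuotientGroup.mk_pow, QuotientGroup.eq_one_iff, Subgroup.mem_subgroupOf]
        simpa using hpowH' h' hh'
      rw [hmk, hc.mul_pow, h1, h2, one_mul]
    -- Cauchy: an element of order `ℓ`
    obtain ⟨q, hq⟩ := exists_prime_orderOf_dvd_card' (G := H ⧸ W'.subgroupOf H) ℓ
      (by rw [hcardQ]; exact dvd_mul_left ℓ d)
    have : ℓ ∣ d := by rw [← hq]; exact orderOf_dvd_of_pow_eq_one (hpowQ q)
    exact hℓd this

end Group

/-! ### A cyclic layer of prime degree with `ζ` in the base: Kummer generator -/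

section Kummer

variable {K₀ Ω : Type*} [Field K₀] [Field Ω] [Algebra K₀ Ω] {ℓ : ℕ} {ζ : Ω}

/-- Iterates of an automorphism fixing `x` fix `x`. [folklore] -/
theorem pow_apply_eq_self_of_apply_eq_self {s : Ω ≃ₐ[K₀] Ω} {x : Ω} (h : s x = x) (i : ℕ) :
    (s ^ i) x = x := by
  induction i with
  | zero => simp
  | succ n ih => rw [pow_succ, AlgEquiv.mul_apply, h, ih]

/-- **Kummer generator by Lagrange resolvents.**  Let `W' ≤ W ≤ Ω ≃ₐ[K₀] Ω` with `W'` normal of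
prime index `ℓ` in `W`, `W` fixing the primitive `ℓ`-th root of unity `ζ`, and `s ∈ W ∖ W'` whose
powers `sⁱ`, `0 < i < ℓ`, move some `W'`-fixed element.  Then some `W'`-fixed `β ≠ 0` satisfies
`s β = ζ β`: the resolvent `β = ∑ᵢ ζ⁻ⁱ sⁱ θ` of a suitable `W'`-fixed `θ`, non-zero for some `θ` by
Dedekind's independence of the characters `sⁱ|_{Ω^{W'}}` (Mathlib `linearIndependent_monoidHom`).
Lang, *Algebra*, Ch. VI §6 (Hilbert's Thm. 90, cyclic case) and §4. [folklore] -/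
theorem exists_kummer_generator (hℓ : ℓ.Prime) (hζ : IsPrimitiveRoot ζ ℓ)
    {W W' : Subgroup (Ω ≃ₐ[K₀] Ω)} (hle : W' ≤ W)
    (hnorm : ∀ w ∈ W, ∀ w' ∈ W', w * w' * w⁻¹ ∈ W') (hidx : W'.relIndex W = ℓ)
    {s : Ω ≃ₐ[K₀] Ω} (hs : s ∈ W) (hζW : ∀ w ∈ W, w ζ = ζ)
    (hsep : ∀ i, 0 < i → i < ℓ → ∃ θ : Ω, (∀ w ∈ W', w θ = θ) ∧ (s ^ i) θ ≠ θ) :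
    ∃ β : Ω, β ≠ 0 ∧ (∀ w ∈ W', w β = β) ∧ s β = ζ * β := by
  classical
  haveI : NeZero ℓ := ⟨hℓ.ne_zero⟩
  have hζ0 : ζ ≠ 0 := hζ.ne_zero hℓ.ne_zero
  set M : IntermediateField K₀ Ω := IntermediateField.fixedField W' with hM
  have hMmem : ∀ {θ : Ω}, θ ∈ M ↔ ∀ w ∈ W', w θ = θ := fun {θ} => by
    rw [hM, IntermediateField.mem_fixedField_iff]
  -- the characters `sⁱ|_M`
  let f : Fin ℓ → (M →* Ω) := fun i =>
    { toFun := fun θ => (s ^ (i : ℕ)) θ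
      map_one' := by simp
      map_mul' := fun x y => by simp }
  have hf : Function.Injective f := by
    intro i j hij
    by_contra hne
    rcases Nat.lt_or_gt_of_ne (fun h => hne (Fin.ext h)) with h | h
    · obtain ⟨θ, hθW', hθ⟩ := hsep (j - i) (Nat.sub_pos_of_lt h) (lt_of_le_of_lt (Nat.sub_le _ _) j.2)
      have := DFunLike.congr_fun hij ⟨θ, hMmem.2 hθW'⟩
      simp only [f, MonoidHom.coe_mk, OneHom.coe_mk] at this
      apply hθ
      apply (s ^ (i : ℕ)).injective
      rw [← AlgEquiv.mul_apply, ← pow_add, Nat.add_sub_cancel' h.le]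
      exact this.symm
    · obtain ⟨θ, hθW', hθ⟩ := hsep (i - j) (Nat.sub_pos_of_lt h) (lt_of_le_of_lt (Nat.sub_le _ _) i.2)
      have := DFunLike.congr_fun hij ⟨θ, hMmem.2 hθW'⟩
      simp only [f, MonoidHom.coe_mk, OneHom.coe_mk] at this
      apply hθ
      apply (s ^ (j : ℕ)).injective
      rw [← AlgEquiv.mul_apply, ← pow_add, Nat.add_sub_cancel' h.le]
      exact this
  have hli := (linearIndependent_monoidHom M Ω).comp f hf
  -- the resolvent with coefficients `ζ⁻ⁱ` is not identically zero
  set c : ℕ → Ω := fun i => ζ⁻¹ ^ i with hc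
  have hex : ∃ θ : M, ∑ i : Fin ℓ, c i * (s ^ (i : ℕ)) (θ : Ω) ≠ 0 := by
    by_contra hall
    simp only [not_exists, ne_eq, not_not] at hall
    have hsum : ∑ i : Fin ℓ, c i • ((f i : M →* Ω) : M → Ω) = 0 := by
      funext θ
      simp only [Finset.sum_apply, Pi.smul_apply, smul_eq_mul, Pi.zero_apply]
      exact hall θ
    have := Fintype.linearIndependent_iff.1 hli (fun i => c i) hsum ⟨0, hℓ.pos⟩
    simp [hc] at this
  obtain ⟨⟨θ, hθM⟩, hθ⟩ := hex
  have hθW' : ∀ w ∈ W', w θ = θ := hMmem.1 hθM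
  set β : Ω := ∑ i : Fin ℓ, c i * (s ^ (i : ℕ)) θ with hβ
  have hsℓ : s ^ ℓ ∈ W' := pow_mem_of_relIndex_prime hle hnorm hℓ hidx hs
  refine ⟨β, hθ, fun w hw => ?_, ?_⟩
  · -- `W'` fixes `β`
    rw [hβ, map_sum]
    refine Finset.sum_congr rfl fun i _ => ?_
    have hwζ : w ζ = ζ := hζW w (hle hw)
    have hconj : (s ^ (i : ℕ))⁻¹ * w * s ^ (i : ℕ) ∈ W' := by
      have := hnorm (s ^ (i : ℕ))⁻¹ (W.inv_mem (W.pow_mem hs _)) w hw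
      rwa [inv_inv] at this
    simp only [hc, map_mul, map_pow, map_inv₀, hwζ]
    congr 1
    calc w ((s ^ (i : ℕ)) θ) = (s ^ (i : ℕ) * ((s ^ (i : ℕ))⁻¹ * w * s ^ (i : ℕ))) θ := by
          rw [← mul_assoc, ← mul_assoc, mul_inv_cancel, one_mul, AlgEquiv.mul_apply]
      _ = (s ^ (i : ℕ)) θ := by rw [AlgEquiv.mul_apply, hθW' _ hconj]
  · -- `s β = ζ β`
    have hsζ : s ζ = ζ := hζW s hs
    have hshift : ∀ i : ℕ, ζ⁻¹ ^ i = ζ * ζ⁻¹ ^ (i + 1) := fun i => by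
      rw [pow_succ]; field_simp
    rw [hβ, map_sum, Finset.mul_sum]
    simp only [hc, map_mul, map_pow, map_inv₀, hsζ]
    rw [Fin.sum_univ_eq_sum_range (fun i => ζ⁻¹ ^ i * s ((s ^ i) θ)) ℓ,
      Fin.sum_univ_eq_sum_range (fun i => ζ * (ζ⁻¹ ^ i * (s ^ i) θ)) ℓ]
    have hterm : ∀ i : ℕ, ζ⁻¹ ^ i * s ((s ^ i) θ) = ζ * (ζ⁻¹ ^ (i + 1) * (s ^ (i + 1)) θ) :=
      fun i => by
        rw [← AlgEquiv.mul_apply, ← pow_succ', hshift i]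
        ring
    rw [Finset.sum_congr rfl (fun i _ => hterm i)]
    have h3 := Finset.sum_range_succ' (fun i => ζ * (ζ⁻¹ ^ i * (s ^ i) θ)) ℓ
    have h4 := Finset.sum_range_succ (fun i => ζ * (ζ⁻¹ ^ i * (s ^ i) θ)) ℓ
    have hlast : ζ * (ζ⁻¹ ^ ℓ * (s ^ ℓ) θ) = ζ * (ζ⁻¹ ^ 0 * (s ^ 0) θ) := by
      rw [inv_pow, hζ.pow_eq_one, inv_one, pow_zero, pow_zero, AlgEquiv.one_apply, hθW' _ hsℓ]
    rw [h4, hlast] at h3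
    exact (add_right_cancel h3).symm

/-- With `β` as in `exists_kummer_generator`: every `w ∈ W` multiplies `β` by a power of `ζ`,
and `b = β ^ ℓ` is fixed by `W`. [folklore] -/
theorem apply_pow_eq_of_kummer (hℓ : ℓ.Prime) (hζ : IsPrimitiveRoot ζ ℓ)
    {W W' : Subgroup (Ω ≃ₐ[K₀] Ω)} (hle : W' ≤ W)
    (hnorm : ∀ w ∈ W, ∀ w' ∈ W', w * w' * w⁻¹ ∈ W') (hidx : W'.relIndex W = ℓ)
    {s : Ω ≃ₐ[K₀] Ω} (hs : s ∈ W) (hs' : s ∉ W') (hζW : ∀ w ∈ W, w ζ = ζ)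
    {β : Ω} (hβW' : ∀ w ∈ W', w β = β) (hsβ : s β = ζ * β) {w : Ω ≃ₐ[K₀] Ω} (hw : w ∈ W) :
    (∃ i < ℓ, w β = ζ ^ i * β) ∧ w (β ^ ℓ) = β ^ ℓ := by
  obtain ⟨i, hi, w', hw', rfl⟩ := exists_pow_mul_mem_of_relIndex_prime hle hnorm hℓ hidx hs hs' hw
  have hsi : ∀ i : ℕ, (s ^ i) β = ζ ^ i * β := fun i => by
    induction i with
    | zero => simp
    | succ n ih =>
        rw [pow_succ, AlgEquiv.mul_apply, hsβ, map_mul, pow_apply_eq_self_of_apply_eq_self (hζW s hs) n,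
          ih, pow_succ]; ring
  have h1 : (s ^ i * w') β = ζ ^ i * β := by rw [AlgEquiv.mul_apply, hβW' w' hw', hsi]
  refine ⟨⟨i, hi, h1⟩, ?_⟩
  rw [map_pow, h1, mul_pow, ← pow_mul, mul_comm i ℓ, pow_mul, hζ.pow_eq_one, one_pow, one_mul]

/-- With `β ≠ 0` as in `exists_kummer_generator`: an element of `W` fixes `β` iff it lies in `W'`
(the stabiliser of `β` in `W` contains `W'`, misses `s`, and `[W : W'] = ℓ` is prime). [folklore] -/
theorem apply_eq_iff_mem_of_kummer (hℓ : ℓ.Prime) (hζ : IsPrimitiveRoot ζ ℓ)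
    {W W' : Subgroup (Ω ≃ₐ[K₀] Ω)} (hle : W' ≤ W)
    (hnorm : ∀ w ∈ W, ∀ w' ∈ W', w * w' * w⁻¹ ∈ W') (hidx : W'.relIndex W = ℓ)
    {s : Ω ≃ₐ[K₀] Ω} (hs : s ∈ W) (hs' : s ∉ W') (hζW : ∀ w ∈ W, w ζ = ζ)
    {β : Ω} (hβ0 : β ≠ 0) (hβW' : ∀ w ∈ W', w β = β) (hsβ : s β = ζ * β)
    {w : Ω ≃ₐ[K₀] Ω} (hw : w ∈ W) : w β = β ↔ w ∈ W' := by
  haveI : NeZero ℓ := ⟨hℓ.ne_zero⟩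
  refine ⟨fun h => ?_, fun h => hβW' w h⟩
  obtain ⟨i, hi, w', hw', rfl⟩ := exists_pow_mul_mem_of_relIndex_prime hle hnorm hℓ hidx hs hs' hw
  have hsi : ∀ i : ℕ, (s ^ i) β = ζ ^ i * β := fun i => by
    induction i with
    | zero => simp
    | succ n ih =>
        rw [pow_succ, AlgEquiv.mul_apply, hsβ, map_mul, pow_apply_eq_self_of_apply_eq_self (hζW s hs) n,
          ih, pow_succ]; ring
  rw [AlgEquiv.mul_apply, hβW' w' hw', hsi] at h
  have hζi : ζ ^ i = 1 := by
    have : ζ ^ i * β = 1 * β := by rw [one_mul]; exact h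
    exact mul_right_cancel₀ hβ0 this
  rw [hζ.pow_eq_one_iff_dvd] at hζi
  have hi0 : i = 0 := Nat.eq_zero_of_dvd_of_lt hζi hi
  rw [hi0, pow_zero, one_mul]
  exact hw'

/-- **Kummer uniqueness.**  With `β ≠ 0` as in `exists_kummer_generator`: an element `γ` fixed by
`W'` whose `ℓ`-th power is fixed by `W` is `e · β ^ j` with `e` fixed by `W` and `s γ = ζ ^ j γ`
(the `W`-fixed field has a unique cyclic degree-`ℓ` Kummer class generating `Ω^{W'}`).
Lang, *Algebra*, Ch. VI §8 (Kummer theory). [folklore] -/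
theorem exists_eq_mul_pow_of_kummer (hℓ : ℓ.Prime) (hζ : IsPrimitiveRoot ζ ℓ)
    {W W' : Subgroup (Ω ≃ₐ[K₀] Ω)} (hle : W' ≤ W)
    (hnorm : ∀ w ∈ W, ∀ w' ∈ W', w * w' * w⁻¹ ∈ W') (hidx : W'.relIndex W = ℓ)
    {s : Ω ≃ₐ[K₀] Ω} (hs : s ∈ W) (hs' : s ∉ W')
    {β : Ω} (hβ0 : β ≠ 0) (hβW' : ∀ w ∈ W', w β = β) (hsβ : s β = ζ * β)
    {γ : Ω} (hγW' : ∀ w ∈ W', w γ = γ) (hγW : ∀ w ∈ W, w (γ ^ ℓ) = γ ^ ℓ) :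
    ∃ j < ℓ, ∃ e : Ω, (∀ w ∈ W, w e = e) ∧ γ = e * β ^ j ∧ s γ = ζ ^ j * γ := by
  haveI : NeZero ℓ := ⟨hℓ.ne_zero⟩
  by_cases hγ0 : γ = 0
  · exact ⟨0, hℓ.pos, 0, fun w _ => map_zero w, by simp [hγ0], by simp [hγ0]⟩
  have hpow : (s γ) ^ ℓ = γ ^ ℓ := by rw [← map_pow, hγW s hs]
  obtain ⟨t, ht, hst⟩ := exists_eq_pow_mul_of_pow_eq hζ hγ0 hpow
  set e : Ω := γ * (β ^ t)⁻¹ with he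
  have hβt : β ^ t ≠ 0 := pow_ne_zero _ hβ0
  have hζ0 : ζ ≠ 0 := hζ.ne_zero hℓ.ne_zero
  have hse : s e = e := by
    rw [he, map_mul, map_inv₀, map_pow, hst, hsβ, mul_pow, mul_inv, mul_mul_mul_comm,
      mul_inv_cancel₀ (pow_ne_zero _ hζ0), one_mul]
  have hW'e : ∀ w ∈ W', w e = e := fun w hw => by
    rw [he, map_mul, map_inv₀, map_pow, hγW' w hw, hβW' w hw]
  refine ⟨t, ht, e, fun w hw => ?_, ?_, hst⟩
  · obtain ⟨i, -, w', hw', rfl⟩ := exists_pow_mul_mem_of_relIndex_prime hle hnorm hℓ hidx hs hs' hw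
    rw [AlgEquiv.mul_apply, hW'e w' hw', pow_apply_eq_self_of_apply_eq_self hse]
  · rw [he, inv_mul_cancel_right₀ hβt]

/-- **Isotypy of the Kummer class.**  With `β ≠ 0` as in `exists_kummer_generator` and
`b = β ^ ℓ`: if `σ` normalises `W` and `W'`, satisfies `s⁻¹ σ⁻¹ s σ ∈ W'` and `σ ζ = ζ ^ n`, then
`σ b = b ^ j · e ^ ℓ` for some `j ≡ n (mod ℓ)` and some `W`-fixed `e` — i.e. the class of `b`
modulo `ℓ`-th powers of the `W`-fixed field is an eigenvector of `σ` for the cyclotomic character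
(this holds because `Ω^{W'}` is abelian over the `σ`-fixed field).  Cohen, *Advanced Topics*,
Thm. 10.2.9; Washington, *Cyclotomic Fields*, §10.2. [folklore] -/
theorem apply_pow_eq_of_comm_of_kummer (hℓ : ℓ.Prime) (hζ : IsPrimitiveRoot ζ ℓ)
    {W W' : Subgroup (Ω ≃ₐ[K₀] Ω)} (hle : W' ≤ W)
    (hnorm : ∀ w ∈ W, ∀ w' ∈ W', w * w' * w⁻¹ ∈ W') (hidx : W'.relIndex W = ℓ)
    {s : Ω ≃ₐ[K₀] Ω} (hs : s ∈ W) (hs' : s ∉ W') (hζW : ∀ w ∈ W, w ζ = ζ)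
    {β : Ω} (hβ0 : β ≠ 0) (hβW' : ∀ w ∈ W', w β = β) (hsβ : s β = ζ * β)
    {σ : Ω ≃ₐ[K₀] Ω} (hσW : ∀ w ∈ W, σ⁻¹ * w * σ ∈ W) (hσW' : ∀ w ∈ W', σ⁻¹ * w * σ ∈ W')
    (hcomm : s⁻¹ * σ⁻¹ * s * σ ∈ W') {n : ℕ} (hσζ : σ ζ = ζ ^ n) :
    ∃ j < ℓ, j ≡ n [MOD ℓ] ∧ ∃ e : Ω, (∀ w ∈ W, w e = e) ∧
      σ (β ^ ℓ) = (β ^ ℓ) ^ j * e ^ ℓ := by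
  haveI : NeZero ℓ := ⟨hℓ.ne_zero⟩
  -- `γ = σ β` is `W'`-fixed with `W`-fixed `ℓ`-th power
  have hγW' : ∀ w ∈ W', w (σ β) = σ β := fun w hw => by
    calc w (σ β) = (σ * (σ⁻¹ * w * σ)) β := by
          rw [← mul_assoc, ← mul_assoc, mul_inv_cancel, one_mul, AlgEquiv.mul_apply]
      _ = σ β := by rw [AlgEquiv.mul_apply, hβW' _ (hσW' w hw)]
  have hbW : ∀ w ∈ W, w (β ^ ℓ) = β ^ ℓ := fun w hw =>
    (apply_pow_eq_of_kummer hℓ hζ hle hnorm hidx hs hs' hζW hβW' hsβ hw).2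
  have hγW : ∀ w ∈ W, w ((σ β) ^ ℓ) = (σ β) ^ ℓ := fun w hw => by
    calc w ((σ β) ^ ℓ) = (σ * (σ⁻¹ * w * σ)) (β ^ ℓ) := by
          rw [← map_pow, ← mul_assoc, ← mul_assoc, mul_inv_cancel, one_mul, AlgEquiv.mul_apply]
      _ = (σ β) ^ ℓ := by rw [AlgEquiv.mul_apply, hbW _ (hσW w hw), map_pow]
  obtain ⟨j, hj, e, heW, hγe, hsγ⟩ :=
    exists_eq_mul_pow_of_kummer hℓ hζ hle hnorm hidx hs hs' hβ0 hβW' hsβ hγW' hγW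
  -- commutation gives `j ≡ n`
  have hsσ : s (σ β) = ζ ^ n * σ β := by
    calc s (σ β) = (s * σ) β := (AlgEquiv.mul_apply _ _ _).symm
      _ = (σ * s * (s⁻¹ * σ⁻¹ * s * σ)) β := by
          rw [show σ * s * (s⁻¹ * σ⁻¹ * s * σ) = s * σ by group]
      _ = σ (s β) := by rw [AlgEquiv.mul_apply, hβW' _ hcomm, AlgEquiv.mul_apply]
      _ = ζ ^ n * σ β := by rw [hsβ, map_mul, hσζ]
  have hσβ0 : σ β ≠ 0 := (map_ne_zero σ).2 hβ0
  have hjn : j ≡ n [MOD ℓ] := by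
    apply modEq_of_pow_eq_pow hζ
    rw [hsγ] at hsσ
    exact mul_right_cancel₀ hσβ0 hsσ
  refine ⟨j, hj, hjn, e, heW, ?_⟩
  rw [map_pow, hγe, mul_pow, ← pow_mul, mul_comm j ℓ, pow_mul, mul_comm]

/-- For `x` with `x ^ ℓ = (β ^ d · z) ^ ℓ`, `ℓ ∤ d`, `z ≠ 0` fixed by `W` (with `β ≠ 0` as in
`exists_kummer_generator`): an element of `W` fixes `x` iff it fixes `β`
(`w x = ζ^{t d} x` when `w β = ζ^t β`). [folklore] -/
theorem apply_eq_iff_apply_eq_of_pow_eq (hℓ : ℓ.Prime) (hζ : IsPrimitiveRoot ζ ℓ)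
    {W W' : Subgroup (Ω ≃ₐ[K₀] Ω)} (hle : W' ≤ W)
    (hnorm : ∀ w ∈ W, ∀ w' ∈ W', w * w' * w⁻¹ ∈ W') (hidx : W'.relIndex W = ℓ)
    {s : Ω ≃ₐ[K₀] Ω} (hs : s ∈ W) (hs' : s ∉ W') (hζW : ∀ w ∈ W, w ζ = ζ)
    {β : Ω} (hβ0 : β ≠ 0) (hβW' : ∀ w ∈ W', w β = β) (hsβ : s β = ζ * β)
    {d : ℕ} (hd : ¬ ℓ ∣ d) {z : Ω} (hz0 : z ≠ 0) (hzW : ∀ w ∈ W, w z = z)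
    {x : Ω} (hx : x ^ ℓ = (β ^ d * z) ^ ℓ) {w : Ω ≃ₐ[K₀] Ω} (hw : w ∈ W) :
    w x = x ↔ w β = β := by
  haveI : NeZero ℓ := ⟨hℓ.ne_zero⟩
  have hy0 : β ^ d * z ≠ 0 := mul_ne_zero (pow_ne_zero _ hβ0) hz0
  obtain ⟨i, -, hxi⟩ := exists_eq_pow_mul_of_pow_eq hζ hy0 hx
  obtain ⟨⟨t, -, hwt⟩, -⟩ := apply_pow_eq_of_kummer hℓ hζ hle hnorm hidx hs hs' hζW hβW' hsβ hw
  have hx0 : x ≠ 0 := by rw [hxi]; exact mul_ne_zero (pow_ne_zero _ (hζ.ne_zero hℓ.ne_zero)) hy0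
  have hwx : w x = ζ ^ (t * d) * x := by
    rw [hxi, map_mul, map_mul, map_pow, map_pow, hζW w hw, hwt, hzW w hw, mul_pow, ← pow_mul]
    ring
  constructor
  · intro h
    rw [hwx] at h
    have h1 : ζ ^ (t * d) = 1 := by
      have : ζ ^ (t * d) * x = 1 * x := by rw [one_mul]; exact h
      exact mul_right_cancel₀ hx0 this
    rw [hζ.pow_eq_one_iff_dvd] at h1
    have h2 : ℓ ∣ t := (hℓ.dvd_mul.1 h1).resolve_right hd
    rw [hwt, (hζ.pow_eq_one_iff_dvd t).2 h2, one_mul]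
  · intro h
    have h1 : ζ ^ t = 1 := by
      have : ζ ^ t * β = 1 * β := by rw [one_mul, ← hwt]; exact h
      exact mul_right_cancel₀ hβ0 this
    rw [hwx, pow_mul, h1, one_pow, one_mul]

/-- `(β ^ d · z) ^ ℓ` (with `ℓ ∤ d`, `z ≠ 0` fixed by `W`) is not the `ℓ`-th power of a `W`-fixed
element: such a root would be fixed by `s`, forcing `s β = β`, i.e. `ζ = 1`. [folklore] -/
theorem pow_ne_of_kummer (hℓ : ℓ.Prime) (hζ : IsPrimitiveRoot ζ ℓ)
    {W W' : Subgroup (Ω ≃ₐ[K₀] Ω)} (hle : W' ≤ W)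
    (hnorm : ∀ w ∈ W, ∀ w' ∈ W', w * w' * w⁻¹ ∈ W') (hidx : W'.relIndex W = ℓ)
    {s : Ω ≃ₐ[K₀] Ω} (hs : s ∈ W) (hs' : s ∉ W') (hζW : ∀ w ∈ W, w ζ = ζ)
    {β : Ω} (hβ0 : β ≠ 0) (hβW' : ∀ w ∈ W', w β = β) (hsβ : s β = ζ * β)
    {d : ℕ} (hd : ¬ ℓ ∣ d) {z : Ω} (hz0 : z ≠ 0) (hzW : ∀ w ∈ W, w z = z)
    {y : Ω} (hyW : ∀ w ∈ W, w y = y) : y ^ ℓ ≠ (β ^ d * z) ^ ℓ := by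
  intro hy
  have h1 := (apply_eq_iff_apply_eq_of_pow_eq hℓ hζ hle hnorm hidx hs hs' hζW hβ0 hβW' hsβ hd hz0
    hzW hy hs).1 (hyW s hs)
  rw [hsβ] at h1
  have hζ1 : ζ = 1 := by
    have : ζ * β = 1 * β := by rw [one_mul]; exact h1
    exact mul_right_cancel₀ hβ0 this
  have h1' : IsPrimitiveRoot ζ 1 := by rw [hζ1]; exact IsPrimitiveRoot.one
  exact hℓ.one_lt.ne' (hζ.unique h1')

end Kummer

end Literature.FieldTheory.Kummer
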